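import Literature.Topology.FourManifolds.StraightLineIsotopyExtension
import Literature.Topology.FourManifolds.Isotopy
import HarnessLib

/-!
# Straight-line isotopy extension, ambient-isotopy form (Hirsch, Ch. 8, Thm. 1.3)

Topic `Literature/Topology/FourManifolds`; companion of `StraightLineIsotopyExtension.lean`.
There, `Literature.Topology.FourManifolds.exists_diffeomorph_eqOn_nhdsSet_of_straightLine` produces, for a compact `Z ⊆ E`, a
`C^∞` map `P` on an open `W ⊇ Z` with `P = id` on `Z` and `D((1 - t) id + t P)` injective along `Z`
for `0 ≤ t ≤ 1`, a *diffeomorphism* `Φ` of `E` with `Φ = P` near `Z` and `Φ = id` off a ball —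
the time-one map of the flow of a compactly supported time-dependent vector field. This file
records the whole flow, i.e. the **diffeotopy** (Hirsch, *Differential Topology* (1976), Ch. 8
§1, Thm. 1.3: "an isotopy of a compact submanifold extends to a diffeotopy of the ambient manifold
having compact support"), in the tree's format `Literature.Topology.FourManifolds.AmbientIsotopy` (`Isotopy.lean`):

* `Literature.Topology.FourManifolds.ODE.tdFlowIsotopy` — the evolution maps `x ↦ Φ_{0,t}(x)` of a compactly supported `C^∞`
  time-dependent field `X : ℝ × E → E` form an ambient isotopy of `E` (jointly smooth, each stage
  a diffeomorphism, stage `0` the identity; Hirsch (1976), Ch. 8 §1, Thm. 1.2: a time-dependent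
  vector field with compact support generates a diffeotopy), all of whose stages are the identity
  off one ball;
* `Literature.Topology.FourManifolds.exists_ambientIsotopy_of_straightLine` — under the hypotheses of
  `exists_diffeomorph_eqOn_nhdsSet_of_straightLine` there is an ambient isotopy `F` of `E` which
  **agrees with the straight-line isotopy `h_t = (1 - t) id + t P` on a neighbourhood of `Z` for
  all `t ∈ [0, 1]`** (in particular `F 1 = P` near `Z`, `exists_ambientIsotopy_of_straightLine_one`)
  and all of whose stages are the identity off one ball (Hirsch (1976), Ch. 8 §1, Thm. 1.4:
  `U ⊆ M` open, `A ⊆ U` compact, `F : U × I → M` an isotopy by open embeddings with `F̂(U × I)`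
  open; then there is a compactly supported diffeotopy of `M` agreeing with `F` on a
  neighbourhood of `A × I`).

The proof is that of `StraightLineIsotopyExtension.lean` verbatim (the track
`Ĥ(t, y) = (t, h_t y)` is a diffeomorphism near `[0, 1] × Z` onto an open `Ω`, the field
`X(t, y) = (P - id)(pr₂ Ĥ⁻¹(t, y))` cut off inside `Ω` is tangent to the straight lines
`t ↦ h_t p` for `p` near `Z`), keeping the flow instead of its time-one map; the older
`exists_diffeomorph_eqOn_nhdsSet_of_straightLine` is the time-one stage of the present statement
(a possible refactor for the librarian: its ~145-line proof can be replaced by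
`exists_ambientIsotopy_of_straightLine_one` and `AmbientIsotopy.toDiffeomorph`). Written for the
uniqueness of tubular neighbourhoods of knots and links in `S³` up to *ambient isotopy*
(`DehnSurgeryTubularUniqueness.lean`), where the orientation convention `det_pos` of
`Literature.Topology.FourManifolds.Knot.TubularNbhd` is transported along isotopies, not along bare diffeomorphisms.

## References

* M. W. Hirsch, *Differential Topology*, GTM 33, Springer (1976), Ch. 8 §1, Thm. 1.2
  (compactly supported time-dependent vector fields generate diffeotopies), Thm. 1.4 (isotopy
  extension near a compact subset of an open set). [HirschDT1976]
* A. Kosinski, *Differential Manifolds*, Academic Press (1993), Ch. II, Thm. (5.2). [Kosinski1993]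
-/

noncomputable section

open Set Metric Filter Topology Function
open scoped ContDiff NNReal Manifold

namespace Literature.Topology.FourManifolds

universe u

/-! ### The flow of a compactly supported time-dependent field as an ambient isotopy -/

namespace ODE

variable {E : Type u} [NormedAddCommGroup E] [NormedSpace ℝ E] [CompleteSpace E]
  {n : ℕ∞} {X : ℝ × E → E}

/-- **The flow of a compactly supported smooth time-dependent vector field is an ambient isotopy**
of the vector space: the evolution maps `x ↦ Φ_{0,t} x` of `u' = X(t, u)` from time `0` to time
`t` are jointly smooth in `(t, x)`, each is a diffeomorphism, and `Φ_{0,0} = id` (Hirsch (1976),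
Ch. 8 §1, Thm. 1.2: a compactly supported time-dependent vector field generates a diffeotopy).
[cite: HirschDT1976, Ch. 8 §1, Thm. 1.2] -/
def tdFlowIsotopy (hX : ContDiff ℝ ∞ X) (hsupp : HasCompactSupport X) :
    AmbientIsotopy 𝓘(ℝ, E) E where
  toFun t := Literature.Analysis.ODE.tdFlow hX hsupp le_top 0 t
  contMDiff := by
    rw [← modelWithCornersSelf_prod, chartedSpaceSelf_prod]
    have h := Literature.Analysis.ODE.contDiff_tdFlow hX hsupp le_top
    exact (h.comp (contDiff_const.prodMk (contDiff_fst.prodMk contDiff_snd))).contMDiff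
  bijective t := (Literature.Analysis.ODE.tdFlowDiffeomorph hX hsupp le_top 0 t).bijective
  isLocalDiffeomorph t := (Literature.Analysis.ODE.tdFlowDiffeomorph hX hsupp le_top 0 t).isLocalDiffeomorph
  map_zero := funext fun x => Literature.Analysis.ODE.tdFlow_self hX hsupp le_top 0 x

/-- The stages of the flow isotopy are the evolution maps from time `0`. [folklore] -/
@[simp]
theorem tdFlowIsotopy_toFun (hX : ContDiff ℝ ∞ X) (hsupp : HasCompactSupport X) (t : ℝ) :
    (tdFlowIsotopy hX hsupp).toFun t = Literature.Analysis.ODE.tdFlow hX hsupp le_top 0 t := rfl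

/-- **All stages of the flow isotopy are the identity off one ball** (the support of the
diffeotopy generated by a compactly supported field is compact). [cite: HirschDT1976, Ch. 8 §1, Thm. 1.2] -/
theorem exists_forall_tdFlowIsotopy_eq_self (hX : ContDiff ℝ ∞ X) (hsupp : HasCompactSupport X) :
    ∃ R : ℝ, ∀ t (y : E), R ≤ ‖y‖ → (tdFlowIsotopy hX hsupp).toFun t y = y := by
  obtain ⟨R, hR⟩ := Literature.Analysis.ODE.exists_forall_le_norm_tdFlow_eq_self hX hsupp le_top
  exact ⟨R, fun t y hy => hR y hy 0 t⟩

end ODE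

/-! ### The straight-line isotopy extension theorem, ambient-isotopy form -/

section Extension

variable {E : Type u} [NormedAddCommGroup E] [NormedSpace ℝ E] [FiniteDimensional ℝ E]

/-- **Isotopy extension for straight-line isotopies near a compact set, diffeotopy form**
(M. W. Hirsch, *Differential Topology* (1976), Ch. 8 §1, Thm. 1.4 — `U ⊆ M` open, `A ⊆ U`
compact, `F` an isotopy of `U`; then a diffeotopy of `M` with compact support agrees with `F` on a
neighbourhood of `A × I` — for `M = E`, `U = W`, `A = Z` and the straight-line isotopy
`h_t = id + t (P - id)`). Let `Z` be a compact subset of a finite-dimensional real normed space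
`E`, `P` a `C^∞` map on an open `W ⊇ Z` with `P z = z` on `Z`, with derivative `D z` at the points
of `Z`, such that `id + t (D z - id)` is injective for all `z ∈ Z`, `t ∈ [0, 1]`. Then there is an
ambient isotopy `F` of `E` (`Literature.Topology.FourManifolds.AmbientIsotopy`: jointly smooth, every stage a diffeomorphism,
`F 0 = id`) which agrees with `h_t` on a neighbourhood of `Z` for every `t ∈ [0, 1]`
(`F t y = h_t y = y + t (P y - y)`), and every stage `F t`, `t ∈ ℝ`, is the identity off one ball.
[cite: HirschDT1976, Ch. 8 §1, Thm. 1.4] -/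
theorem exists_ambientIsotopy_of_straightLine {Z W : Set E} (hZ : IsCompact Z)
    (hW : IsOpen W) (hZW : Z ⊆ W) {P : E → E} (hP : ContDiffOn ℝ ∞ P W)
    (hPZ : ∀ z ∈ Z, P z = z) {D : E → E →L[ℝ] E} (hD : ∀ z ∈ Z, HasFDerivAt P (D z) z)
    (hinj : ∀ z ∈ Z, ∀ t ∈ Icc (0 : ℝ) 1, Injective (slDeriv t (D z))) :
    ∃ F : AmbientIsotopy 𝓘(ℝ, E) E,
      (∀ᶠ y in 𝓝ˢ Z, ∀ t ∈ Icc (0 : ℝ) 1, F.toFun t y = slIsotopy P t y) ∧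
      ∃ R : ℝ, ∀ t (y : E), R ≤ ‖y‖ → F.toFun t y = y := by
  have hPdiff : ∀ y ∈ W, HasFDerivAt P (fderiv ℝ P y) y := fun y hy =>
    ((hP.contDiffAt (hW.mem_nhds hy)).differentiableAt (by simp)).hasFDerivAt
  have hDeq : ∀ z ∈ Z, fderiv ℝ P z = D z := fun z hz => (hD z hz).fderiv
  -- Step 1: the set `S` of `(t, y)`, `y ∈ W`, where `id + t (DP(y) - id)` is invertible is open
  set A : ℝ × E → E →L[ℝ] E := fun q => slDeriv q.1 (fderiv ℝ P q.2) with hA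
  have hAcont : ContinuousOn A ((univ : Set ℝ) ×ˢ W) := by
    have hf : ContinuousOn (fun q : ℝ × E => fderiv ℝ P q.2) ((univ : Set ℝ) ×ˢ W) :=
      (hP.continuousOn_fderiv_of_isOpen hW (by simp)).comp continuousOn_snd fun q hq => hq.2
    simp only [hA, slDeriv]
    exact continuousOn_const.add (continuousOn_fst.smul (hf.sub continuousOn_const))
  set S : Set (ℝ × E) := ((univ : Set ℝ) ×ˢ W) ∩ A ⁻¹' {u | IsUnit u} with hS
  have hSopen : IsOpen S := hAcont.isOpen_inter_preimage (isOpen_univ.prod hW) Units.isOpen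
  -- the equivalences `T q` and the derivative of the track on `S`
  have hequiv : ∀ q ∈ S, ∃ T : (ℝ × E) ≃L[ℝ] ℝ × E,
      HasFDerivAt (slTrack P) (T : ℝ × E →L[ℝ] ℝ × E) q := by
    rintro ⟨t, y⟩ ⟨⟨-, hyW⟩, hunit⟩
    have hunit' : IsUnit (slDeriv t (fderiv ℝ P y)) := hunit
    set L : E ≃L[ℝ] E := ContinuousLinearEquiv.unitsEquiv ℝ E hunit'.unit with hL
    have hLcoe : (L : E →L[ℝ] E) = slDeriv t (fderiv ℝ P y) := by
      rw [hL]; ext η; simp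
    refine ⟨slTrackEquiv L (P y - y), ?_⟩
    rw [coe_slTrackEquiv L hLcoe]
    exact hasFDerivAt_slTrack (hPdiff y hyW)
  have hKS : Icc (0 : ℝ) 1 ×ˢ Z ⊆ S := by
    rintro ⟨t, z⟩ ⟨ht, hz⟩
    refine ⟨⟨mem_univ _, hZW hz⟩, ?_⟩
    show IsUnit (slDeriv t (fderiv ℝ P z))
    rw [hDeq z hz]
    obtain ⟨L, hL⟩ := exists_equiv_slDeriv (hinj z hz t ht)
    exact ⟨ContinuousLinearEquiv.toUnit L, by rw [← hL]; rfl⟩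
  -- Step 2: injectivity of the track near `[0, 1] × Z`
  have hK : IsCompact (Icc (0 : ℝ) 1 ×ˢ Z) := isCompact_Icc.prod hZ
  have htrack_cont : ContinuousOn (slTrack P) ((univ : Set ℝ) ×ˢ W) :=
    (contDiffOn_slTrack hP).continuousOn
  have htrack_at : ∀ q ∈ S, ContDiffAt ℝ ∞ (slTrack P) q := fun q hq =>
    (contDiffOn_slTrack hP).contDiffAt ((isOpen_univ.prod hW).mem_nhds hq.1)
  obtain ⟨V, hVopen, hKV, hVinj⟩ : ∃ V : Set (ℝ × E), IsOpen V ∧ Icc (0 : ℝ) 1 ×ˢ Z ⊆ V ∧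
      InjOn (slTrack P) V := by
    refine exists_isOpen_injOn_of_isCompact hK (fun q hq => ?_) (fun q hq q' hq' h => ?_)
      (fun q hq => ?_)
    · exact (htrack_at q (hKS hq)).continuousAt
    · obtain ⟨t, z⟩ := q
      obtain ⟨t', z'⟩ := q'
      rw [slTrack_of_eq P (hPZ z hq.2), slTrack_of_eq P (hPZ z' hq'.2)] at h
      exact h
    · obtain ⟨T, hT⟩ := hequiv q (hKS hq)
      have hstrict : HasStrictFDerivAt (slTrack P) (T : ℝ × E →L[ℝ] ℝ × E) q := by
        have h1 := (htrack_at q (hKS hq)).hasStrictFDerivAt (by simp)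
        rwa [hT.fderiv] at h1
      exact ⟨_, (hstrict.toOpenPartialHomeomorph _).open_source.mem_nhds
        hstrict.mem_toOpenPartialHomeomorph_source,
        (hstrict.toOpenPartialHomeomorph _).injOn⟩
  -- Step 3: a product neighbourhood `J × U` of `[0, 1] × Z` inside `S ∩ V`
  obtain ⟨J₀, U₀, hJ₀, hU₀, hIJ₀, hZU₀, hJU₀⟩ :=
    generalized_tube_lemma isCompact_Icc hZ (hSopen.inter hVopen)
      (subset_inter hKS hKV)
  obtain ⟨δ, hδ, hδJ⟩ := isCompact_Icc.exists_thickening_subset_open hJ₀ hIJ₀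
  set J : Set ℝ := Ioo (-δ) (1 + δ) with hJ
  have hJsub : J ⊆ J₀ := by
    intro s hs
    apply hδJ
    rw [mem_thickening_iff]
    rcases le_or_gt s 0 with h0 | h0
    · refine ⟨0, left_mem_Icc.2 zero_le_one, ?_⟩
      rw [dist_comm, Real.dist_eq, zero_sub, abs_neg, abs_of_nonpos h0]
      linarith [hs.1]
    rcases le_or_gt s 1 with h1 | h1
    · exact ⟨s, ⟨h0.le, h1⟩, by rw [dist_self]; exact hδ⟩
    · refine ⟨1, right_mem_Icc.2 zero_le_one, ?_⟩
      rw [Real.dist_eq, abs_of_pos (by linarith)]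
      linarith [hs.2]
  obtain ⟨R₀, hR₀⟩ := hZ.isBounded.subset_ball 0
  set U : Set E := U₀ ∩ ball 0 R₀ with hU
  have hUopen : IsOpen U := hU₀.inter isOpen_ball
  have hZU : Z ⊆ U := subset_inter hZU₀ hR₀
  set O : Set (ℝ × E) := J ×ˢ U with hO
  have hOopen : IsOpen O := isOpen_Ioo.prod hUopen
  have hOS : O ⊆ S := fun q hq => (hJU₀ ⟨hJsub hq.1, hq.2.1⟩).1
  have hOV : O ⊆ V := fun q hq => (hJU₀ ⟨hJsub hq.1, hq.2.1⟩).2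
  have h0J : (0 : ℝ) ∈ J := ⟨by linarith, by linarith⟩
  have hUW : U ⊆ W := fun y hy => by
    have : ((0 : ℝ), y) ∈ S := hOS ⟨h0J, hy⟩
    exact this.1.2
  -- Step 4: the track as a partial diffeomorphism `e : O ≅ Ω`
  have hOinj : InjOn (slTrack P) O := hVinj.mono hOV
  set e₀ : PartialEquiv (ℝ × E) (ℝ × E) := hOinj.toPartialEquiv (slTrack P) O with he₀
  have hopenmap : IsOpenMap (O.restrict (slTrack P)) := by
    rw [isOpenMap_iff_nhds_le]
    rintro ⟨q, hq⟩
    obtain ⟨T, hT⟩ := hequiv q (hOS hq)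
    have hstrict : HasStrictFDerivAt (slTrack P) (T : ℝ × E →L[ℝ] ℝ × E) q := by
      have h1 := (htrack_at q (hOS hq)).hasStrictFDerivAt (by simp)
      rwa [hT.fderiv] at h1
    have hmap : map (O.restrict (slTrack P)) (𝓝 ⟨q, hq⟩) = map (slTrack P) (𝓝 q) := by
      rw [restrict_eq, ← Filter.map_map, map_nhds_subtype_val, hOopen.nhdsWithin_eq hq]
    rw [hmap, hstrict.map_nhds_eq_of_equiv]
    exact le_rfl
  set e : OpenPartialHomeomorph (ℝ × E) (ℝ × E) :=
    OpenPartialHomeomorph.ofContinuousOpenRestrict e₀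
      (htrack_cont.mono fun q hq => ⟨mem_univ _, hUW hq.2⟩) hopenmap hOopen with he
  have hecoe : ⇑e = slTrack P := rfl
  have hesource : e.source = O := rfl
  have hesymm_smooth : ContDiffOn ℝ ∞ e.symm e.target := by
    intro b hb
    have hb' : e.symm b ∈ O := e.map_target hb
    obtain ⟨T, hT⟩ := hequiv _ (hOS hb')
    exact (e.contDiffAt_symm hb hT (htrack_at _ (hOS hb'))).contDiffWithinAt
  -- Step 5: the vector field on `Ω = e.target` and its cutoff
  set Ω : Set (ℝ × E) := e.target with hΩ
  have hΩopen : IsOpen Ω := e.open_target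
  set Y : ℝ × E → E := fun q => P (e.symm q).2 - (e.symm q).2 with hY
  have hYsmooth : ContDiffOn ℝ ∞ Y Ω := by
    have h2 : ContDiffOn ℝ ∞ (fun q => (e.symm q).2) Ω := hesymm_smooth.snd
    have hmaps : MapsTo (fun q => (e.symm q).2) Ω W := fun q hq => hUW (e.map_target hq).2
    exact (hP.comp h2 hmaps).sub h2
  -- a compact neighbourhood `Zc` of `Z` in `U` and the compact set `C'` of the track
  obtain ⟨Zc, hZc, hZZc, hZcU⟩ := exists_compact_between hZ hUopen hZU
  set C' : Set (ℝ × E) := slTrack P '' (Icc (-(δ / 2)) (1 + δ / 2) ×ˢ Zc) with hC'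
  have hIccJ : Icc (-(δ / 2)) (1 + δ / 2) ⊆ J := fun s hs =>
    ⟨by linarith [hs.1], by linarith [hs.2]⟩
  have hCO : Icc (-(δ / 2)) (1 + δ / 2) ×ˢ Zc ⊆ O := prod_mono hIccJ hZcU
  have hC'cpt : IsCompact C' := (isCompact_Icc.prod hZc).image_of_continuousOn
    ((htrack_cont.mono fun q hq => ⟨mem_univ _, hUW hq.2⟩).mono hCO)
  have hC'Ω : C' ⊆ Ω := by
    rintro _ ⟨q, hq, rfl⟩
    exact e.map_source (show q ∈ e.source from hCO hq)
  obtain ⟨t₁, ht₁, hC't₁, ht₁Ω⟩ := exists_compact_between hC'cpt hΩopen hC'Ω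
  obtain ⟨ρ, hρ1, hρ0, hρ01⟩ := exists_contMDiffMap_one_nhds_of_subset_interior 𝓘(ℝ, ℝ × E)
    hC'cpt.isClosed hC't₁ (n := (⊤ : ℕ∞))
  have hρsmooth : ContDiff ℝ ∞ (ρ : ℝ × E → ℝ) := contMDiff_iff_contDiff.1 ρ.contMDiff
  set X : ℝ × E → E := fun q => (ρ q) • Y q with hX
  have hXsmooth : ContDiff ℝ ∞ X := by
    refine contDiff_iff_contDiffAt.2 fun q => ?_
    by_cases hq : q ∈ Ω
    · exact (hρsmooth.contDiffAt).smul (hYsmooth.contDiffAt (hΩopen.mem_nhds hq))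
    · have hq' : q ∉ t₁ := fun h => hq (ht₁Ω h)
      have hev : X =ᶠ[𝓝 q] fun _ => 0 := by
        filter_upwards [ht₁.isClosed.isOpen_compl.mem_nhds hq'] with q' hq''
        simp only [hX, hρ0 q' hq'', zero_smul]
      exact contDiffAt_const.congr_of_eventuallyEq hev
  have hXsupp : HasCompactSupport X := by
    refine HasCompactSupport.of_support_subset_isCompact ht₁ fun q hq => ?_
    by_contra hq'
    exact hq (by simp only [hX, hρ0 q hq', zero_smul])
  -- Step 6: the flow, as an ambient isotopy
  have hn : (1 : ℕ∞) ≤ ⊤ := le_top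
  refine ⟨ODE.tdFlowIsotopy hXsmooth hXsupp, ?_, ODE.exists_forall_tdFlowIsotopy_eq_self hXsmooth hXsupp⟩
  -- agreement with `h_t` on `interior Zc` for `t ∈ [0, 1]`
  have hagree : ∀ p ∈ interior Zc, ∀ t ∈ Icc (0 : ℝ) 1,
      (ODE.tdFlowIsotopy hXsmooth hXsupp).toFun t p = slIsotopy P t p := by
    intro p hp t ht
    have hpZc : p ∈ Zc := interior_subset hp
    -- the straight line `s ↦ h_s p` is an integral curve of `X` on `(-δ/2, 1 + δ/2)`
    have hcurve : ∀ s ∈ Ioo (-(δ / 2)) (1 + δ / 2),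
        HasDerivAt (fun s => slIsotopy P s p) (X (s, slIsotopy P s p)) s := by
      intro s hs
      have hsO : (s, p) ∈ O := hCO ⟨Ioo_subset_Icc_self hs, hpZc⟩
      have hval : X (s, slIsotopy P s p) = P p - p := by
        have hmemC' : (s, slIsotopy P s p) ∈ C' := ⟨(s, p), ⟨Ioo_subset_Icc_self hs, hpZc⟩, rfl⟩
        have hρq : ρ (s, slIsotopy P s p) = 1 := hρ1.self_of_nhdsSet _ hmemC'
        have hsymm : e.symm (s, slIsotopy P s p) = (s, p) := by
          have := e.left_inv (show (s, p) ∈ e.source from hsO)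
          simpa [hecoe] using this
        simp only [hX, hY, hρq, one_smul, hsymm]
      rw [hval]
      have h1 : HasDerivAt (fun s : ℝ => s • (P p - p)) ((1 : ℝ) • (P p - p)) s :=
        (hasDerivAt_id s).smul_const _
      rw [one_smul] at h1
      have h2 := h1.const_add p
      exact h2
    have key := Literature.Analysis.ODE.tdFlow_eq_of_hasDerivAt hXsmooth hXsupp hn (γ := fun s => slIsotopy P s p)
      (a := -(δ / 2)) (b := 1 + δ / 2) (t₀ := 0) ⟨by linarith, by linarith⟩ hcurve (t := t)
      ⟨by linarith [ht.1], by linarith [ht.2]⟩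
    simp only [slIsotopy_zero] at key
    rw [ODE.tdFlowIsotopy_toFun]
    exact key
  exact Filter.eventually_of_mem (isOpen_interior.mem_nhdsSet.2 hZZc) hagree

/-- **Time-one form** of `exists_ambientIsotopy_of_straightLine`: an ambient isotopy of `E`,
compactly supported uniformly in `t`, whose time-one map is `P` on a neighbourhood of `Z` (the
statement of `Literature.Topology.FourManifolds.exists_diffeomorph_eqOn_nhdsSet_of_straightLine` with the isotopy remembered).
[cite: HirschDT1976, Ch. 8 §1, Thm. 1.4] -/
theorem exists_ambientIsotopy_of_straightLine_one {Z W : Set E} (hZ : IsCompact Z)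
    (hW : IsOpen W) (hZW : Z ⊆ W) {P : E → E} (hP : ContDiffOn ℝ ∞ P W)
    (hPZ : ∀ z ∈ Z, P z = z) {D : E → E →L[ℝ] E} (hD : ∀ z ∈ Z, HasFDerivAt P (D z) z)
    (hinj : ∀ z ∈ Z, ∀ t ∈ Icc (0 : ℝ) 1, Injective (slDeriv t (D z))) :
    ∃ F : AmbientIsotopy 𝓘(ℝ, E) E, (∀ᶠ y in 𝓝ˢ Z, F.toFun 1 y = P y) ∧
      ∃ R : ℝ, ∀ t (y : E), R ≤ ‖y‖ → F.toFun t y = y := by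
  obtain ⟨F, hF, hR⟩ := exists_ambientIsotopy_of_straightLine hZ hW hZW hP hPZ hD hinj
  refine ⟨F, ?_, hR⟩
  filter_upwards [hF] with y hy
  rw [hy 1 (right_mem_Icc.2 zero_le_one), slIsotopy_one]

end Extension

end Literature.Topology.FourManifolds

end
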